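import Summits.CriticalPhenomena.PercolationContinuityZ3.Theorems.PercNearOneGluingNoHeavyQuantGateMoveBlobCellsZero
import Summits.CriticalPhenomena.PercolationContinuityZ3.Theorems.PercNearOneGluingNoHeavyQuantGateMoveBlobCells
import Summits.CriticalPhenomena.PercolationContinuityZ3.Theorems.PercNearOneGluingNoHeavyQuantDECAtTMixtures
import Summits.CriticalPhenomena.PercolationContinuityZ3.Theorems.PercNearOneGluingNoHeavyQuantGatedSliceWindow
import HarnessLib

/-!
# QUANT lane R8, T-DEC, leg (III), blob case — `LawDec.GatedSliceMixLaw'`: the two Q-ALONE cells that are one step from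
# kernel criteria — (Q1) the shifted top below the layer (`k₂ + a ≤ j`: Theorem A) and (Q2′) no nonzero `t`-low (the zero-only
# cells) — and the RESIDUAL REGIME R of the node stated exactly

builds on p205010 (kernel theorem, internal audit signed; external expert review pending)

Support file (`--supports stmt-CriticalPhenomena-4575`), QUANT lane seat prim-quant-arm-1 (gen 41), rung R8 of
`run/shared/lean/prim/quant/LADDER.md`.  Theorems only, standard axioms, no sorries, no definitions.  Companion of
`…QuantGatedSliceMixLawPrime` (typer g29: the node `GatedSliceMixLaw'`), `…QuantGatedSliceMixLawTwoPoint` (typer g29: cell `k₁ = 0`,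
`k₂ ≥ a`), `…QuantGateMoveBlobCellsZero` (lead g30: `gateCell_laws`, `gateCell_decAtT_of_noLow`) and `…QuantLawDEC` (Theorem A
`decAt_of_top_le`).

THE NODE (README V324–V327).  `GatedSliceMixLaw'`: in the frame `0 < y < 1`, `0 ≤ z < 1`, `g ≤ 1`, `y ≤ (1−z)g`, `1 ≤ a`, `j < M + a`,
`0 < S`, `y·M ≤ S`, for a mid `h` (`S < h ≤ min(j, M)`) whose weak-mid law `W_h` is NOT DEC at `(y, t, j)`, `t = S + ag(1−z)`, and a
two-point law `μ₂ = {k₁, k₂; λ}` on `{0..M}` with `(1−z)(k₁ + (k₂−k₁)λ) = S`, SOME mixture `θ·W_h + (1−θ)·Q`, `0 ≤ θ < 1`, is DEC at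
`(y, t, j)` on `{0..M+a}`, where `Q := zδ₀ + (1−z)·slice μ₂ a g` (atoms `0, k₁, k₁+a, k₂, k₂+a`; mass `1`, mean `t`).

THIS FILE: the cells in which `Q` ITSELF is DEC for a reason already in the kernel, so that `θ = 0` witnesses the node.
* (Q1) **`k₂ + a ≤ j`** — every atom of `Q` lies at or below the layer and `Q` is top-affordable AT ITS OWN MEAN: `y·(k₂ + a) ≤ y·M + y·a ≤
  S + a(1−z)g = t`; Theorem A (`decAt_of_top_le`, Lemma P + `credit_ge_mean_of_TA`) on `{0..k₂+a}`, then `decAtT_mono_top`.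
  (`mixLawQ_decAtT_of_top_le`, `gatedSliceMixLaw'_of_top_le`.)
* (Q2′) **no nonzero `t`-low among `Q`'s charged atoms** (`Q l = 0` for `1 ≤ l ≤ j`, `2l < t`) — the zero rides every atom above `t` at
  the moment rates: lead g30's `gateCell_decAtT_of_noLow` verbatim.  (`mixLawQ_decAtT_of_noLow`, `gatedSliceMixLaw'_of_noLow`; and the
  position form `gatedSliceMixLaw'_of_k₁_notLow`: `k₁` not a `t`-low (so `k₁ ≥ 1`) — then neither are `k₁ + a`, `k₂`, `k₂ + a`.)
EXACT CENSUS (this seat, `work/explore/qdec.py` on the lane's exact LP engines; 146 132 (parameters, μ₂) cases, `z = 0` and the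
corners `y·M = S`, `y = (1−z)g`, `S = (1−z)M` included): `Q` fails to be DEC at `(y, t, j)` ONLY IF `k₂ + a ≥ j + 1` AND `1 ≤ k₁ ≤ j`,
`2k₁ < t` (760 / 760 non-DEC cases; `k₁ + a` is then also a `t`-low in 755, an absorber in 5; = lead g31 LEAD-NOTES N121 independently).
Hence **the residual of the node after this file and the typer's `k₁ = 0` cells is REGIME R: `k₂ + a ≥ j + 1 ∧ 1 ≤ k₁ ≤ j ∧ 2k₁ < t`**
(the deep unshifted low `k₁` with the shifted top a giant), where the genuine mixtures live (exact θ-intervals: `work/explore/regR.py`;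
in regime R there are ALSO `Q`-DEC cells in which only `θ = 0` is feasible, so no constant `θ > 0` is universal).
HONEST STATUS: `GatedSliceMixLaw'` (regime R), CW, `GateMove`, `GatedConvEmptyFree`, `SingleGateConvClosed`, `TreeDEC`, `FarTreeRow` OPEN;
RATE class log\* / honest sentence of `run/shared/lean/prim/quant/README.md` unchanged.

[this work]; Theorem A: this lane (`…QuantLawDEC`); zero-only cells: lead g30; node: typer g29 (this lane).  Nothing here is cited as a
published result.  The gluing rows served [cite: KozmaNitzan2024, Conjecture 3 (p. 15)]; product measure [cite: Grimmett1999, §1.3 p. 10].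
-/

noncomputable section

namespace Summit.CriticalPhenomena.PercolationContinuityZ3.Theorems

namespace Quant

open Finset

/-- the two-point law `{lo, hi; g}` (as in `…QuantLawDEC`) -/
local notation3 "TP[" lo ", " hi ", " g ", " h "]" =>
  (g : ℝ) * (if (h : ℕ) = (hi : ℕ) then (1 : ℝ) else 0) + (1 - (g : ℝ)) * (if (h : ℕ) = (lo : ℕ) then (1 : ℝ) else 0)

namespace LawDec

/-! ### (Q1) the shifted top at or below the layer: Theorem A -/

/-- **(Q1) `Q = zδ₀ + (1−z)·slice {k₁,k₂;λ} a g` IS DEC AT `(y, t, j)` WHEN `k₂ + a ≤ j`.**  Frame: `0 ≤ y < 1`, `0 ≤ z ≤ 1`, `0 ≤ g ≤ 1`,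
`y ≤ (1−z)g`, `0 ≤ λ ≤ 1`, `k₁ ≤ k₂ ≤ M`, top-affordability `y·M ≤ (1−z)(k₁ + (k₂−k₁)λ)` (`= S`).  Then `Q` is supported in `{0..k₂+a}`,
has mean `t = S + ag − zag`, and every charged atom `p` has `y·p ≤ y(k₂+a) ≤ S + y·a ≤ t`; Theorem A (`decAt_of_top_le`) gives DEC at every
layer `j ≥ k₂ + a` on `{0..k₂+a}`, hence on `{0..M+a}` (`decAtT_mono_top`). [this work] -/
theorem mixLawQ_decAtT_of_top_le (y z g lam : ℝ) (a j M k₁ k₂ : ℕ)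
    (hy0 : 0 ≤ y) (hy1 : y < 1) (hz0 : 0 ≤ z) (hz1 : z ≤ 1) (hg0 : 0 ≤ g) (hg1 : g ≤ 1) (hyg : y ≤ (1 - z) * g)
    (hk : k₁ ≤ k₂) (hk₂M : k₂ ≤ M) (hlam0 : 0 ≤ lam) (hlam1 : lam ≤ 1)
    (hta : y * (M : ℝ) ≤ (1 - z) * ((k₁ : ℝ) + ((k₂ : ℝ) - k₁) * lam))
    (htop : k₂ + a ≤ j) :
    DECAtT y ((1 - z) * ((k₁ : ℝ) + ((k₂ : ℝ) - k₁) * lam) + (a : ℝ) * g - z * (a : ℝ) * g) j (M + a)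
      (fun p => z * (if p = 0 then (1 : ℝ) else 0) + (1 - z) * slice (fun q => TP[k₁, k₂, lam, q]) a g p) := by
  obtain ⟨q0, qM, q1, qmean⟩ := gateCell_laws z g lam a k₂ k₁ k₂ hz0 hz1 hg0 hg1 hlam0 hlam1 hk le_rfl
  set Q : ℕ → ℝ := fun p => z * (if p = 0 then (1 : ℝ) else 0) + (1 - z) * slice (fun q => TP[k₁, k₂, lam, q]) a g p with hQ
  -- top-affordability of `Q` at its own mean
  have hmean : ∑ h ∈ Finset.range (k₂ + a + 1), (h : ℝ) * Q h
      = (1 - z) * ((k₁ : ℝ) + ((k₂ : ℝ) - k₁) * lam) + (a : ℝ) * g - z * (a : ℝ) * g := by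
    rw [hQ, qmean]; ring
  have hTA : ∀ h, 0 < Q h → y * (h : ℝ) ≤ ∑ p ∈ Finset.range (k₂ + a + 1), (p : ℝ) * Q p := by
    intro h hh
    have hle : h ≤ k₂ + a := by
      by_contra hc
      exact absurd (qM h (not_le.1 hc)) (ne_of_gt hh)
    rw [hmean]
    have h1 : y * (h : ℝ) ≤ y * ((k₂ : ℝ) + a) := by
      refine mul_le_mul_of_nonneg_left ?_ hy0
      exact_mod_cast hle
    have h2 : y * (k₂ : ℝ) ≤ y * M := mul_le_mul_of_nonneg_left (by exact_mod_cast hk₂M) hy0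
    have h3 : y * (a : ℝ) ≤ (1 - z) * g * (a : ℝ) := mul_le_mul_of_nonneg_right hyg (Nat.cast_nonneg a)
    nlinarith
  have hA := decAt_of_top_le (k₂ + a) Q q0 qM q1 y hy1 hTA j htop
  rw [decAt_iff_decAtT, hmean] at hA
  exact decAtT_mono_top hA (by omega)

/-- **(Q1) in the node's binder: `GatedSliceMixLaw'` holds with `θ = 0` whenever `k₂ + a ≤ j`** (the weak-mid law, `h`, and the
non-DEC hypothesis are not used). [this work] -/
theorem gatedSliceMixLaw'_of_top_le (y z g S lam : ℝ) (a j M h k₁ k₂ : ℕ)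
    (hy0 : 0 < y) (hy1 : y < 1) (hz0 : 0 ≤ z) (hz1 : z < 1) (hg1 : g ≤ 1) (hyg : y ≤ (1 - z) * g)
    (hta : y * (M : ℝ) ≤ S) (hk : k₁ ≤ k₂) (hk₂M : k₂ ≤ M) (hlam0 : 0 ≤ lam) (hlam1 : lam ≤ 1)
    (hmean : (1 - z) * ((k₁ : ℝ) + ((k₂ : ℝ) - k₁) * lam) = S) (htop : k₂ + a ≤ j) :
    ∃ θ : ℝ, 0 ≤ θ ∧ θ < 1 ∧
      DECAtT y (S + (a : ℝ) * g * (1 - z)) j (M + a)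
        (fun p => θ * weakMidLaw S g h a p
          + (1 - θ) * (z * (if p = 0 then (1 : ℝ) else 0) + (1 - z) * slice (fun q => TP[k₁, k₂, lam, q]) a g p)) := by
  have hg0 : 0 ≤ g := by
    by_contra hc
    have : (1 - z) * g < 0 := mul_neg_of_pos_of_neg (by linarith) (not_le.1 hc)
    linarith
  refine ⟨0, le_rfl, zero_lt_one, ?_⟩
  have hdec := mixLawQ_decAtT_of_top_le y z g lam a j M k₁ k₂ hy0.le hy1 hz0 hz1.le hg0 hg1 hyg hk hk₂M hlam0 hlam1
    (by rw [hmean]; exact hta) htop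
  have ht : (1 - z) * ((k₁ : ℝ) + ((k₂ : ℝ) - k₁) * lam) + (a : ℝ) * g - z * (a : ℝ) * g = S + (a : ℝ) * g * (1 - z) := by
    rw [hmean]; ring
  rw [ht] at hdec
  refine decAtT_congr (fun p => ?_) hdec
  ring

/-! ### (Q2′) no nonzero `t`-low: the zero-only cells -/

/-- **(Q2′) `Q` IS DEC AT `(y, t, j)` WHEN IT HAS NO NONZERO `t`-LOW** (`Q l = 0` for `1 ≤ l ≤ j`, `2l < t`): lead g30's
`gateCell_decAtT_of_noLow` with the target rewritten to `S + ag(1−z)`. [this work] -/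
theorem mixLawQ_decAtT_of_noLow (y z g S lam : ℝ) (a j M k₁ k₂ : ℕ)
    (hy0 : 0 < y) (hy1 : y < 1) (hz0 : 0 ≤ z) (hz1 : z < 1) (hg1 : g ≤ 1) (hyg : y ≤ (1 - z) * g) (ha : 1 ≤ a)
    (hta : y * (M : ℝ) ≤ S) (hk : k₁ ≤ k₂) (hk₂M : k₂ ≤ M) (hlam0 : 0 ≤ lam) (hlam1 : lam ≤ 1)
    (hmean : (1 - z) * ((k₁ : ℝ) + ((k₂ : ℝ) - k₁) * lam) = S)
    (hnz : ∀ l, 1 ≤ l → l ≤ j → 2 * (l : ℝ) < S + (a : ℝ) * g * (1 - z) →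
      z * (if l = 0 then (1 : ℝ) else 0) + (1 - z) * slice (fun q => TP[k₁, k₂, lam, q]) a g l = 0) :
    DECAtT y (S + (a : ℝ) * g * (1 - z)) j (M + a)
      (fun p => z * (if p = 0 then (1 : ℝ) else 0) + (1 - z) * slice (fun q => TP[k₁, k₂, lam, q]) a g p) := by
  have ht : (1 - z) * ((k₁ : ℝ) + ((k₂ : ℝ) - k₁) * lam) + (a : ℝ) * g - z * (a : ℝ) * g = S + (a : ℝ) * g * (1 - z) := by
    rw [hmean]; ring
  have hdec := gateCell_decAtT_of_noLow y z g lam a j M k₁ k₂ hy0 hy1 hz0 hz1 hg1 hyg ha hk hk₂M hlam0 hlam1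
    (by rw [hmean]; exact hta) (fun l hl1 hlj hlow => hnz l hl1 hlj (by rw [← ht]; exact hlow))
  rw [ht] at hdec
  exact hdec

/-- **(Q2′) in the node's binder: `GatedSliceMixLaw'` holds with `θ = 0` whenever `Q` has no nonzero `t`-low.** [this work] -/
theorem gatedSliceMixLaw'_of_noLow (y z g S lam : ℝ) (a j M h k₁ k₂ : ℕ)
    (hy0 : 0 < y) (hy1 : y < 1) (hz0 : 0 ≤ z) (hz1 : z < 1) (hg1 : g ≤ 1) (hyg : y ≤ (1 - z) * g) (ha : 1 ≤ a)
    (hta : y * (M : ℝ) ≤ S) (hk : k₁ ≤ k₂) (hk₂M : k₂ ≤ M) (hlam0 : 0 ≤ lam) (hlam1 : lam ≤ 1)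
    (hmean : (1 - z) * ((k₁ : ℝ) + ((k₂ : ℝ) - k₁) * lam) = S)
    (hnz : ∀ l, 1 ≤ l → l ≤ j → 2 * (l : ℝ) < S + (a : ℝ) * g * (1 - z) →
      z * (if l = 0 then (1 : ℝ) else 0) + (1 - z) * slice (fun q => TP[k₁, k₂, lam, q]) a g l = 0) :
    ∃ θ : ℝ, 0 ≤ θ ∧ θ < 1 ∧
      DECAtT y (S + (a : ℝ) * g * (1 - z)) j (M + a)
        (fun p => θ * weakMidLaw S g h a p
          + (1 - θ) * (z * (if p = 0 then (1 : ℝ) else 0) + (1 - z) * slice (fun q => TP[k₁, k₂, lam, q]) a g p)) := by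
  refine ⟨0, le_rfl, zero_lt_one, ?_⟩
  refine decAtT_congr (fun p => ?_)
    (mixLawQ_decAtT_of_noLow y z g S lam a j M k₁ k₂ hy0 hy1 hz0 hz1 hg1 hyg ha hta hk hk₂M hlam0 hlam1 hmean hnz)
  ring

/-- **(Q2′) by positions: `k₁` NOT a `t`-low (`t ≤ 2k₁` or `j < k₁`; forces `k₁ ≥ 1`) ⟹ `GatedSliceMixLaw'` with `θ = 0`.**  Then
every nonzero atom of `Q` (`k₁ ≤ k₁ + a`, `k₁ ≤ k₂ ≤ k₂ + a`) is at least `k₁`, hence not a `t`-low either. [this work] -/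
theorem gatedSliceMixLaw'_of_k₁_notLow (y z g S lam : ℝ) (a j M h k₁ k₂ : ℕ)
    (hy0 : 0 < y) (hy1 : y < 1) (hz0 : 0 ≤ z) (hz1 : z < 1) (hg1 : g ≤ 1) (hyg : y ≤ (1 - z) * g) (ha : 1 ≤ a)
    (hta : y * (M : ℝ) ≤ S) (hk : k₁ ≤ k₂) (hk₂M : k₂ ≤ M) (hlam0 : 0 ≤ lam) (hlam1 : lam ≤ 1)
    (hmean : (1 - z) * ((k₁ : ℝ) + ((k₂ : ℝ) - k₁) * lam) = S)
    (hnotlow : S + (a : ℝ) * g * (1 - z) ≤ 2 * (k₁ : ℝ) ∨ j < k₁) :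
    ∃ θ : ℝ, 0 ≤ θ ∧ θ < 1 ∧
      DECAtT y (S + (a : ℝ) * g * (1 - z)) j (M + a)
        (fun p => θ * weakMidLaw S g h a p
          + (1 - θ) * (z * (if p = 0 then (1 : ℝ) else 0) + (1 - z) * slice (fun q => TP[k₁, k₂, lam, q]) a g p)) := by
  refine gatedSliceMixLaw'_of_noLow y z g S lam a j M h k₁ k₂ hy0 hy1 hz0 hz1 hg1 hyg ha hta hk hk₂M hlam0 hlam1 hmean ?_
  intro l hl1 hlj hlow
  -- `l < k₁`: the atom `l` is not charged by `Q`
  have hlk : l < k₁ := by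
    rcases hnotlow with h2 | h2
    · by_contra hc
      have : (k₁ : ℝ) ≤ l := by exact_mod_cast not_lt.1 hc
      linarith
    · omega
  have hl0 : l ≠ 0 := by omega
  rw [if_neg hl0, mul_zero, zero_add]
  have hTP : ∀ q, q < k₁ → TP[k₁, k₂, lam, q] = 0 := by
    intro q hq
    rw [if_neg (by omega), if_neg (by omega)]; ring
  have hsl : slice (fun q => TP[k₁, k₂, lam, q]) a g l = 0 := by
    simp only [slice]
    rw [hTP l hlk]
    by_cases hal : a ≤ l
    · rw [if_pos hal, hTP (l - a) (by omega)]; ring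
    · rw [if_neg hal]; ring
  rw [hsl, mul_zero]

end LawDec

end Quant

end Summit.CriticalPhenomena.PercolationContinuityZ3.Theorems
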